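import Literature.AnabelianGeometry.SemiGraphs.PSCEdgeLikeIncidenceCriteria
import HarnessLib

/-!
# [CombGC] Prop. 1.5 (i): the incidence criterion with CONJUGATED branch representatives (dual graphs with cycles)

Mochizuki, *A combinatorial version of the Grothendieck conjecture* [CombGC] §1, Prop. 1.5 (i), p. 12
[cite: MochizukiCombGC2007, Prop 1.5(i) p.12].  abc-iut-w4-d081's criterion `edgeLikeIncidence_of`
(`PSCEdgeLikeIncidenceCriteria.lean`) asks that every node group lie in the chosen REPRESENTATIVES
`Π_{u₁}`, `Π_{u₂}` of its two end vertices (trivial branch conjugators).  On a dual graph with a CYCLE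
(first Betti number `≥ 1`, e.g. the two-node-cycle data of abc-iut-f-164 gen 5,
`PSCSeparatingCoveringsTwoNodeCycle.lean`: `Π_{n₁} = cl⟨ι b_m⟩ ≤ Π_{v₁}` but only
`≤ ι(a_m)⁻¹ Π_{v₀} ι(a_m)`) no choice of representatives trivialises all branch conjugators at once — their
product around the cycle is the free letter of `Π^unr`.  This PROOF-ONLY file (abc-iut-f-164 gen 5,
successor input for row «TWO-NODE-CYCLE·PROP15») records the same criterion with ARBITRARY branch
conjugators `β`: `Π_e ≤ β₁Π_{u₁}`, `Π_e ≤ β₂Π_{u₂}`, `β₁Π_{u₁} ≠ β₂Π_{u₂}`; malnormality of the verticial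
representatives again makes the (conjugate) verticial overgroups unique.

* `smul_eq_smul_of_le_smul` — uniqueness from malnormality, conjugated form;
* `edgeLikeIncidence_of_conj` — the criterion.
No side is taken on [IUTchIII] Cor. 3.12.
-/

namespace Literature.AnabelianGeometry.SemiGraphs

namespace PSCDatum

open scoped Pointwise

universe u

variable {P : Type u} [Group P] [TopologicalSpace P]

omit [TopologicalSpace P] in
/-- **Uniqueness from malnormality, conjugated**: if `Y` is malnormal and a non-trivial `X ≤ βY` also lies
in `δY`, then `δY = βY`. [cite: MochizukiCombGC2007, Prop 1.5(i) p.12] -/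
theorem smul_eq_smul_of_le_smul {X Y : Subgroup P}
    (hmal : ∀ g : P, Y ⊓ ConjAct.toConjAct g • Y ≠ ⊥ → g ∈ Y) (hX : X ≠ ⊥) (β : ConjAct P)
    (hXβ : X ≤ β • Y) (δ : ConjAct P) (hXδ : X ≤ δ • Y) : δ • Y = β • Y := by
  have hX' : β⁻¹ • X ≠ ⊥ := fun h => hX (by
    have h' := congrArg (fun Z : Subgroup P => β • Z) h
    simpa only [smul_inv_smul, Subgroup.smul_bot] using h')
  have h1 : β⁻¹ • X ≤ Y := by
    have := Subgroup.pointwise_smul_le_pointwise_smul_iff (a := β⁻¹) |>.mpr hXβ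
    rwa [inv_smul_smul] at this
  have h2 : β⁻¹ • X ≤ (β⁻¹ * δ) • Y := by
    rw [mul_smul]
    exact Subgroup.pointwise_smul_le_pointwise_smul_iff.mpr hXδ
  have h3 := smul_eq_of_le_of_le_smul hmal hX' h1 (β⁻¹ * δ) h2
  have h4 := congrArg (fun Z : Subgroup P => β • Z) h3
  simpa only [← mul_smul, mul_inv_cancel_left] using h4

/-- **Prop. 1.5 (i) from malnormal verticial representatives and CONJUGATED incidence data.**
Hypotheses: every `Π_v` is malnormal; each node group `Π_e ≠ 1` lies in conjugates `β₁Π_{u₁} ≠ β₂Π_{u₂}`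
of the representatives of its end vertices and meets every conjugate of `Π_w` (`w ∉ {u₁,u₂}`) and of
every cusp group trivially; each cusp group `Π_c ≠ 1` lies in a conjugate `βΠ_u` and meets every
conjugate of `Π_w` (`w ≠ u`) trivially.  Then a cuspidal subgroup lies in exactly one verticial subgroup,
a nodal one in exactly two. [cite: MochizukiCombGC2007, Prop 1.5(i) p.12] -/
theorem edgeLikeIncidence_of_conj (G : PSCDatum P)
    (hmal : ∀ (v : G.graph.V) (g : P),
      G.vertGp v ⊓ ConjAct.toConjAct g • G.vertGp v ≠ ⊥ → g ∈ G.vertGp v)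
    (hNbot : ∀ e, G.nodeGp e ≠ ⊥) (hCbot : ∀ c, G.cuspGp c ≠ ⊥)
    (hNC : ∀ (e : G.graph.N) (c : G.graph.C) (g : P),
      G.nodeGp e ⊓ ConjAct.toConjAct g • G.cuspGp c = ⊥)
    (hNends : ∀ e : G.graph.N, ∃ (u₁ u₂ : G.graph.V) (β₁ β₂ : ConjAct P),
      G.nodeGp e ≤ β₁ • G.vertGp u₁ ∧ G.nodeGp e ≤ β₂ • G.vertGp u₂ ∧
      β₁ • G.vertGp u₁ ≠ β₂ • G.vertGp u₂ ∧
      ∀ w, w ≠ u₁ → w ≠ u₂ → ∀ g : P, G.nodeGp e ⊓ ConjAct.toConjAct g • G.vertGp w = ⊥)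
    (hCend : ∀ c : G.graph.C, ∃ (u : G.graph.V) (β : ConjAct P), G.cuspGp c ≤ β • G.vertGp u ∧
      ∀ w, w ≠ u → ∀ g : P, G.cuspGp c ⊓ ConjAct.toConjAct g • G.vertGp w = ⊥) :
    G.EdgeLikeIncidence := by
  -- an edge group inside `δ Π_w` with `w` not an end vertex is impossible
  have key : ∀ (X : Subgroup P) (w : G.graph.V), X ≠ ⊥ →
      (∀ g : P, X ⊓ ConjAct.toConjAct g • G.vertGp w = ⊥) → ∀ δ : ConjAct P, ¬ X ≤ δ • G.vertGp w := by
    intro X w hX h δ hle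
    apply hX
    have := h (ConjAct.ofConjAct δ)
    rw [ConjAct.toConjAct_ofConjAct] at this
    exact le_bot_iff.mp (this ▸ le_inf le_rfl hle)
  -- `X ≤ (γ⁻¹δ)Y` and `(γ⁻¹δ)Y = βY` give `δY = (γβ)Y`
  have lift : ∀ (γ δ β : ConjAct P) (Y : Subgroup P), (γ⁻¹ * δ) • Y = β • Y → δ • Y = (γ * β) • Y := by
    intro γ δ β Y h
    have h' := congrArg (fun Z : Subgroup P => γ • Z) h
    simpa only [← mul_smul, mul_inv_cancel_left] using h'
  intro E hE
  rcases hE with ⟨e, γ, rfl⟩ | ⟨c, γ, rfl⟩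
  · -- nodal
    obtain ⟨u₁, u₂, β₁, β₂, h₁, h₂, hne, hoth⟩ := hNends e
    have hnotcusp : ¬ G.IsCuspidal (γ • G.nodeGp e) := by
      rintro ⟨c, δ, hδ⟩
      apply hNbot e
      have h0 := hNC e c (ConjAct.ofConjAct (γ⁻¹ * δ))
      rw [ConjAct.toConjAct_ofConjAct] at h0
      have hle : G.nodeGp e ≤ (γ⁻¹ * δ) • G.cuspGp c := by
        rw [← smul_le_smul_iff_le_inv_mul_smul, hδ]
      exact le_bot_iff.mp (h0 ▸ le_inf le_rfl hle)
    -- the verticial subgroups containing `γ Π_e` are exactly `γβ₁ Π_{u₁}`, `γβ₂ Π_{u₂}`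
    have hchar : ∀ A : Subgroup P, (G.IsVerticial A ∧ γ • G.nodeGp e ≤ A) ↔
        (A = (γ * β₁) • G.vertGp u₁ ∨ A = (γ * β₂) • G.vertGp u₂) := by
      intro A
      constructor
      · rintro ⟨⟨w, δ, rfl⟩, hle⟩
        rw [smul_le_smul_iff_le_inv_mul_smul] at hle
        by_cases hw₁ : w = u₁
        · subst hw₁
          left
          exact lift γ δ β₁ _ (smul_eq_smul_of_le_smul (hmal w) (hNbot e) β₁ h₁ _ hle)
        by_cases hw₂ : w = u₂
        · subst hw₂
          right
          exact lift γ δ β₂ _ (smul_eq_smul_of_le_smul (hmal w) (hNbot e) β₂ h₂ _ hle)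
        exact absurd hle (key _ w (hNbot e) (hoth w hw₁ hw₂) _)
      · rintro (rfl | rfl)
        · exact ⟨⟨u₁, γ * β₁, rfl⟩, by
            rw [mul_smul]; exact Subgroup.pointwise_smul_le_pointwise_smul_iff.mpr h₁⟩
        · exact ⟨⟨u₂, γ * β₂, rfl⟩, by
            rw [mul_smul]; exact Subgroup.pointwise_smul_le_pointwise_smul_iff.mpr h₂⟩
    have hne' : (γ * β₁) • G.vertGp u₁ ≠ (γ * β₂) • G.vertGp u₂ := fun h => by
      rw [mul_smul, mul_smul] at h
      exact hne (smul_left_cancel γ h)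
    refine ⟨⟨fun h => absurd h hnotcusp, fun ⟨A, hA, huniq⟩ => ?_⟩,
      ⟨fun _ => ⟨_, _, hne', hchar⟩, fun _ => hnotcusp⟩⟩
    -- uniqueness fails: both qualify
    have e₁ := huniq _ ((hchar _).mpr (Or.inl rfl))
    have e₂ := huniq _ ((hchar _).mpr (Or.inr rfl))
    exact absurd (e₁.trans e₂.symm) hne'
  · -- cuspidal
    obtain ⟨u, β, hu, hoth⟩ := hCend c
    have hcusp : G.IsCuspidal (γ • G.cuspGp c) := ⟨c, γ, rfl⟩
    -- the unique verticial subgroup containing `γ Π_c` is `γβ Π_u`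
    have hchar : ∀ A : Subgroup P, (G.IsVerticial A ∧ γ • G.cuspGp c ≤ A) ↔ A = (γ * β) • G.vertGp u := by
      intro A
      constructor
      · rintro ⟨⟨w, δ, rfl⟩, hle⟩
        rw [smul_le_smul_iff_le_inv_mul_smul] at hle
        by_cases hw : w = u
        · subst hw
          exact lift γ δ β _ (smul_eq_smul_of_le_smul (hmal w) (hCbot c) β hu _ hle)
        · exact absurd hle (key _ w (hCbot c) (hoth w hw) _)
      · rintro rfl
        exact ⟨⟨u, γ * β, rfl⟩, by
          rw [mul_smul]; exact Subgroup.pointwise_smul_le_pointwise_smul_iff.mpr hu⟩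
    refine ⟨⟨fun _ => ⟨(γ * β) • G.vertGp u, (hchar _).mpr rfl, fun A hA => (hchar A).mp hA⟩,
      fun _ => hcusp⟩, ⟨fun h => absurd hcusp h, ?_⟩⟩
    rintro ⟨A₁, A₂, hne, hall⟩
    have e₁ : A₁ = (γ * β) • G.vertGp u := (hchar _).mp ((hall A₁).mpr (Or.inl rfl))
    have e₂ : A₂ = (γ * β) • G.vertGp u := (hchar _).mp ((hall A₂).mpr (Or.inr rfl))
    exact absurd (e₁.trans e₂.symm) hne

end PSCDatum

end Literature.AnabelianGeometry.SemiGraphs
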